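import Literature.MathematicalPhysics.KineticTheory.SiteChainResponseRevGenerator
import Literature.MathematicalPhysics.KineticTheory.SiteChainResponseCutoff
import Literature.MathematicalPhysics.KineticTheory.SiteChainResponsePairing
import Literature.MathematicalPhysics.KineticTheory.SiteChainReversal
import Literature.MathematicalPhysics.KineticTheory.ConfinedBackward
import HarnessLib

/-!
# The backward identity for energy-weighted pairings of site-inhomogeneous chains (truncated form)

Topic `Literature/MathematicalPhysics/KineticTheory`, grouping namespace `…KineticTheory.HeatConduction`.
For the Langevin kernels `P_t = SiteChain.langevinKernel N T_L T_R t` of a uniformly confining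
site-dependent chain (`N ≥ 1`), the model-free backward equation for pair observables
(`ConfinedBackward.lean`: duality with respect to Lebesgue measure — the drift has divergence `-2γ`,
`SiteChainReversal.lean` — and Dynkin's identity for the reversed kernels) applied to the compactly
supported pair observable `H_R(x, y) = χ(H(x)/R) e^{θH(x)} · χ(H(y)/R) φ(y)`:

* `SiteChain.contDiff_truncPair`, `SiteChain.UniformlyConfining.hasCompactSupport_truncPair`,
  `SiteChain.sdeGeneratorFst_truncPair` — regularity, support, and the first-variable reversed
  generator `L̂₁ H_R (x, y) = χ(H(y)/R) φ(y) · L̂(χ(H/R) e^{θH})(x)`;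
* `SiteChain.UniformlyConfining.pairAct_truncPair`, `pairAct_sdeGeneratorFst_truncPair`,
  `continuous_pairing_truncPair` — the pair actions in kernel form and their continuity in time;
* `SiteChain.UniformlyConfining.truncated_integrated_identity` — for `R = n + 1` and `t ≥ 0`:
  `∫ χ_R e^{θH} P_t(χ_R φ) dx - ∫ χ_R e^{θH} χ_R φ dx
     = ∫₀ᵗ ( 2γ ∫ χ_R e^{θH} P_s(χ_R φ) dx + ∫ P_s(χ_R φ) · L̂(χ_R e^{θH}) dx ) ds`
  (fundamental theorem of calculus for the pair action, whose derivative is the pair action of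
  `Lᵀ₁ H_R = 2γ H_R + L̂₁ H_R`).

## References

* N. Cuneo, J.-P. Eckmann, M. Hairer, L. Rey-Bellet, Electron. J. Probab. **23** (2018) no. 55, §3.1
  (`L*` is the formal adjoint of the generator).
* U. G. Haussmann, É. Pardoux, *Time reversal of diffusions*, Ann. Probab. **14** (1986) 1188–1205.
* D. W. Stroock, S. R. S. Varadhan, *Multidimensional Diffusion Processes* (1979), §3.1.

## Design choices

* `C²` potentials suffice (`SiteChain.UniformlyConfining`); `φ ∈ C²` is needed for the pair
  observable to be `C²`.
* NOT here: removing the truncation `R → ∞` (`SiteChainResponseBackwardLimit.lean`).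
-/

noncomputable section

open MeasureTheory ProbabilityTheory Filter Topology Set
open scoped NNReal ENNReal ContDiff

namespace Literature.MathematicalPhysics.KineticTheory.HeatConduction

open Literature.Probability.Process Literature.MathematicalPhysics.KineticTheory

variable {N : ℕ}

namespace SiteChain

variable (P : SiteChain)

/-! ### The truncated pair observable -/

/-- `χ(H/R) e^{θH}` is `C²` for a `C²` energy. [folklore] -/
theorem contDiff_truncExpWeight_hamiltonian (hH : ContDiff ℝ 2 (P.hamiltonian N)) (θ R : ℝ) :
    ContDiff ℝ 2 (fun y : PhaseSpace N =>
      smoothCutoff (P.hamiltonian N y / R) * Real.exp (θ * P.hamiltonian N y)) :=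
  (contDiff_two_truncExpWeight θ R).comp hH

variable {φ : PhaseSpace N → ℝ}

/-- The pair observable `H_R(x,y) = χ(H(x)/R) e^{θH(x)} · χ(H(y)/R) φ(y)` is `C²` for `H, φ ∈ C²`.
[folklore] -/
theorem contDiff_truncPair (hH : ContDiff ℝ 2 (P.hamiltonian N)) (θ R : ℝ) (hφ2 : ContDiff ℝ 2 φ) :
    ContDiff ℝ 2 (fun p : PhaseSpace N × PhaseSpace N =>
      (smoothCutoff (P.hamiltonian N p.1 / R) * Real.exp (θ * P.hamiltonian N p.1)) *
        (smoothCutoff (P.hamiltonian N p.2 / R) * φ p.2)) := by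
  have h1 : ContDiff ℝ 2 (fun p : PhaseSpace N × PhaseSpace N =>
      smoothCutoff (P.hamiltonian N p.1 / R) * Real.exp (θ * P.hamiltonian N p.1)) :=
    (P.contDiff_truncExpWeight_hamiltonian hH θ R).comp contDiff_fst
  have h2 : ContDiff ℝ 2 (fun p : PhaseSpace N × PhaseSpace N => smoothCutoff (P.hamiltonian N p.2 / R)) :=
    ((contDiff_smoothCutoff (n := 2)).comp ((hH.comp contDiff_snd).div_const R))
  have h3 : ContDiff ℝ 2 (fun p : PhaseSpace N × PhaseSpace N => φ p.2) := hφ2.comp contDiff_snd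
  exact h1.mul (h2.mul h3)

/-- **The first-variable reversed generator of the pair observable**:
`L̂₁ H_R (x, y) = χ(H(y)/R) φ(y) · L̂(χ(H/R) e^{θH})(x)` (`L̂` the generator of the reversed drift
`-Y` with the bath directions `v_L, v_R`). [folklore] -/
theorem sdeGeneratorFst_truncPair (hH : ContDiff ℝ 2 (P.hamiltonian N)) (θ R T_L T_R : ℝ)
    (φ : PhaseSpace N → ℝ) (x y : PhaseSpace N) :
    sdeGeneratorFst (fun y => -P.langevinDrift N y) (P.noiseVecL N T_L) (P.noiseVecR N T_R)
        (fun p : PhaseSpace N × PhaseSpace N =>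
          (smoothCutoff (P.hamiltonian N p.1 / R) * Real.exp (θ * P.hamiltonian N p.1)) *
            (smoothCutoff (P.hamiltonian N p.2 / R) * φ p.2)) (x, y) =
      (smoothCutoff (P.hamiltonian N y / R) * φ y) *
        sdeGenerator (fun y => -P.langevinDrift N y) (P.noiseVecL N T_L) (P.noiseVecR N T_R)
          (fun y => smoothCutoff (P.hamiltonian N y / R) * Real.exp (θ * P.hamiltonian N y)) x := by
  rw [sdeGeneratorFst_apply]
  have : (fun x' : PhaseSpace N =>
      (smoothCutoff (P.hamiltonian N x' / R) * Real.exp (θ * P.hamiltonian N x')) *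
        (smoothCutoff (P.hamiltonian N y / R) * φ y)) = fun x' =>
      (smoothCutoff (P.hamiltonian N y / R) * φ y) *
        (smoothCutoff (P.hamiltonian N x' / R) * Real.exp (θ * P.hamiltonian N x')) := funext fun x' => by ring
  rw [this, sdeGenerator_const_mul _ _ _ (P.contDiff_truncExpWeight_hamiltonian hH θ R)]

namespace UniformlyConfining

variable {P} (hP : P.UniformlyConfining) (N : ℕ) (T_L T_R : ℝ) (θ : ℝ)
include hP

/-- The pair observable has compact support (`R > 0`). [folklore] -/
theorem hasCompactSupport_truncPair (φ : PhaseSpace N → ℝ) {R : ℝ} (hR : 0 < R) :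
    HasCompactSupport (fun p : PhaseSpace N × PhaseSpace N =>
      (smoothCutoff (P.hamiltonian N p.1 / R) * Real.exp (θ * P.hamiltonian N p.1)) *
        (smoothCutoff (P.hamiltonian N p.2 / R) * φ p.2)) := by
  have hK : IsCompact {x : PhaseSpace N | P.hamiltonian N x ≤ 2 * R} := hP.isCompact_setOf_hamiltonian_le N (2 * R)
  refine HasCompactSupport.intro (hK.prod hK) fun p hp => ?_
  rw [Set.mem_prod, not_and_or] at hp
  rcases hp with h | h
  · simp only [Set.mem_setOf_eq, not_le] at h
    rw [truncExpWeight_eq_zero_of_le hR h.le, zero_mul]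
  · simp only [Set.mem_setOf_eq, not_le] at h
    rw [smoothCutoff_of_two_le ((le_div_iff₀ hR).2 h.le), zero_mul, mul_zero]

omit hP in
/-- **The pair action of `H_R` in kernel form**: `pairAct H_R s = ∫ χ_R e^{θH}(x) · P_s(χ_R φ)(x) dx`.
[folklore] -/
theorem pairAct_truncPair (φ : PhaseSpace N → ℝ) (R : ℝ) (s : ℝ≥0) :
    pairAct (P.langevinDrift N) (P.noiseVecL N T_L) (P.noiseVecR N T_R) volume
        (fun p : PhaseSpace N × PhaseSpace N =>
          (smoothCutoff (P.hamiltonian N p.1 / R) * Real.exp (θ * P.hamiltonian N p.1)) *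
            (smoothCutoff (P.hamiltonian N p.2 / R) * φ p.2)) s =
      ∫ x, (smoothCutoff (P.hamiltonian N x / R) * Real.exp (θ * P.hamiltonian N x)) *
        ∫ y, smoothCutoff (P.hamiltonian N y / R) * φ y ∂(P.langevinKernel N T_L T_R s x) := by
  rw [pairAct_def]
  simp only [integral_const_mul]
  rfl

/-- **The pair action of `L̂₁ H_R` in kernel form**:
`pairAct (L̂₁ H_R) s = ∫ P_s(χ_R φ)(x) · L̂(χ_R e^{θH})(x) dx`. [folklore] -/
theorem pairAct_sdeGeneratorFst_truncPair (R : ℝ) (φ : PhaseSpace N → ℝ) (s : ℝ≥0) :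
    pairAct (P.langevinDrift N) (P.noiseVecL N T_L) (P.noiseVecR N T_R) volume
        (sdeGeneratorFst (fun y => -P.langevinDrift N y) (P.noiseVecL N T_L) (P.noiseVecR N T_R)
          (fun p : PhaseSpace N × PhaseSpace N =>
            (smoothCutoff (P.hamiltonian N p.1 / R) * Real.exp (θ * P.hamiltonian N p.1)) *
              (smoothCutoff (P.hamiltonian N p.2 / R) * φ p.2))) s =
      ∫ x, (∫ y, smoothCutoff (P.hamiltonian N y / R) * φ y ∂(P.langevinKernel N T_L T_R s x)) *
        sdeGenerator (fun y => -P.langevinDrift N y) (P.noiseVecL N T_L) (P.noiseVecR N T_R)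
          (fun y => smoothCutoff (P.hamiltonian N y / R) * Real.exp (θ * P.hamiltonian N y)) x := by
  rw [pairAct_def]
  simp_rw [P.sdeGeneratorFst_truncPair (hP.contDiff_hamiltonian N) θ R T_L T_R φ]
  simp only [integral_mul_const]
  rfl

variable {φ : PhaseSpace N → ℝ} (hφ2 : ContDiff ℝ 2 φ)
include hφ2

/-- **The kernel-form pair action of `L̂₁ H_R` is continuous in time** (`R > 0`). [folklore] -/
theorem continuous_pairing_truncPair {R : ℝ} (hR : 0 < R) :
    Continuous fun s : ℝ =>
      ∫ x, (∫ y, smoothCutoff (P.hamiltonian N y / R) * φ y ∂(P.langevinKernel N T_L T_R s.toNNReal x)) *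
        sdeGenerator (fun y => -P.langevinDrift N y) (P.noiseVecL N T_L) (P.noiseVecR N T_R)
          (fun y => smoothCutoff (P.hamiltonian N y / R) * Real.exp (θ * P.hamiltonian N y)) x := by
  haveI := isAddHaarMeasure_volume_phaseSpace N
  have hY'c : Continuous fun y => -P.langevinDrift N y :=
    (P.contDiff_one_langevinDrift hP.contDiff_U hP.contDiff_V N).continuous.neg
  simp_rw [← hP.pairAct_sdeGeneratorFst_truncPair N T_L T_R θ R φ]
  exact (hP.confinedDrift N).toConfinedDrift.continuous_pairAct (hP.noiseVecL_mem_noise N T_L)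
    (hP.noiseVecR_mem_noise N T_R) volume
    (continuous_sdeGeneratorFst hY'c (P.contDiff_truncPair (hP.contDiff_hamiltonian N) θ R hφ2))
    (hasCompactSupport_sdeGeneratorFst (hP.hasCompactSupport_truncPair N θ φ hR))

/-- The kernel-form pair action of `H_R` is continuous in time (`R > 0`). [folklore] -/
theorem continuous_pairAct_truncPair {R : ℝ} (hR : 0 < R) :
    Continuous fun s : ℝ =>
      ∫ x, (smoothCutoff (P.hamiltonian N x / R) * Real.exp (θ * P.hamiltonian N x)) *
        ∫ y, smoothCutoff (P.hamiltonian N y / R) * φ y ∂(P.langevinKernel N T_L T_R s.toNNReal x) := by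
  haveI := isAddHaarMeasure_volume_phaseSpace N
  simp_rw [← pairAct_truncPair N T_L T_R θ φ R]
  exact (hP.confinedDrift N).toConfinedDrift.continuous_pairAct (hP.noiseVecL_mem_noise N T_L)
    (hP.noiseVecR_mem_noise N T_R) volume (P.contDiff_truncPair (hP.contDiff_hamiltonian N) θ R hφ2).continuous
    (hP.hasCompactSupport_truncPair N θ φ hR)

/-- **The truncated backward identity in integrated form.** For `R = n + 1`, `χ_R = χ(H/R)`, `N ≥ 1`
and every `t ≥ 0`:
`∫ χ_R e^{θH} P_t(χ_R φ) dx - ∫ χ_R e^{θH} χ_R φ dx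
   = ∫₀ᵗ ( 2γ ∫ χ_R e^{θH} P_s(χ_R φ) dx + ∫ P_s(χ_R φ) L̂(χ_R e^{θH}) dx ) ds`
(fundamental theorem of calculus for `s ↦ pairAct H_R s`, whose derivative is
`pairAct (Lᵀ₁ H_R) = 2γ pairAct H_R + pairAct (L̂₁ H_R)`; `tr DY = -2γ`).
[cite: CuneoEckmannHairerReyBellet2018, §3.1] -/
theorem truncated_integrated_identity (hN : 0 < N) (n : ℕ) (t : ℝ≥0) :
    (∫ x, (smoothCutoff (P.hamiltonian N x / (n + 1)) * Real.exp (θ * P.hamiltonian N x)) *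
        ∫ y, smoothCutoff (P.hamiltonian N y / (n + 1)) * φ y ∂(P.langevinKernel N T_L T_R t x)) -
      ∫ x, (smoothCutoff (P.hamiltonian N x / (n + 1)) * Real.exp (θ * P.hamiltonian N x)) *
        (smoothCutoff (P.hamiltonian N x / (n + 1)) * φ x) =
      ∫ s in (0 : ℝ)..t,
        (2 * P.γ * (∫ x, (smoothCutoff (P.hamiltonian N x / (n + 1)) * Real.exp (θ * P.hamiltonian N x)) *
            ∫ y, smoothCutoff (P.hamiltonian N y / (n + 1)) * φ y ∂(P.langevinKernel N T_L T_R s.toNNReal x)) +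
          ∫ x, (∫ y, smoothCutoff (P.hamiltonian N y / (n + 1)) * φ y ∂(P.langevinKernel N T_L T_R s.toNNReal x)) *
            sdeGenerator (fun y => -P.langevinDrift N y) (P.noiseVecL N T_L) (P.noiseVecR N T_R)
              (fun y => smoothCutoff (P.hamiltonian N y / (n + 1)) * Real.exp (θ * P.hamiltonian N y)) x) := by
  haveI := isAddHaarMeasure_volume_phaseSpace N
  have hY'c : Continuous fun y => -P.langevinDrift N y :=
    (P.contDiff_one_langevinDrift hP.contDiff_U hP.contDiff_V N).continuous.neg
  have hR : (0 : ℝ) < n + 1 := by positivity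
  have hHn2 := P.contDiff_truncPair (hP.contDiff_hamiltonian N) θ (n + 1) hφ2
  have hHnc := hP.hasCompactSupport_truncPair N θ φ hR
  set D := (hP.confinedDrift N).toConfinedDrift with hD
  -- the pair action as a function of real time, its derivative and their continuity
  have hFc := hP.continuous_pairAct_truncPair N T_L T_R θ hφ2 hR
  have hLc := hP.continuous_pairing_truncPair N T_L T_R θ hφ2 hR
  have hderiv := fun (s : ℝ) (hs : 0 < s) => D.hasDerivAt_pairAct
    (hP.noiseVecL_mem_noise N T_L) (hP.noiseVecR_mem_noise N T_R) volume (hP.reversedDrift N)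
    (hP.noiseVecL_mem_reversedDrift_noise N T_L) (hP.noiseVecR_mem_reversedDrift_noise N T_R)
    (fun _ => rfl) (P.trace_fderiv_langevinDrift_U2 hP.contDiff_U hP.contDiff_V hN) hHn2 hHnc hs
  simp only [pairAct_truncPair N T_L T_R θ φ (n + 1),
    hP.pairAct_sdeGeneratorFst_truncPair N T_L T_R θ (n + 1) φ, neg_neg] at hderiv
  -- fundamental theorem of calculus on `[0, t]`
  have hftc := intervalIntegral.integral_eq_sub_of_hasDerivAt_of_le t.coe_nonneg hFc.continuousOn
    (fun s hs => hderiv s hs.1) (((continuous_const.mul hFc).add hLc).intervalIntegrable _ _)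
  simp only [Real.toNNReal_coe, Real.toNNReal_zero, hP.langevinKernel_zero N T_L T_R,
    ProbabilityTheory.Kernel.id_apply, integral_dirac] at hftc
  rw [← hftc]

end UniformlyConfining

end SiteChain

end Literature.MathematicalPhysics.KineticTheory.HeatConduction
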